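import Literature.NumberTheory.GelbartRogawski1991.DoubledUnitaryAdaptedRelations
import HarnessLib

/-!
# The factors of an Iwahori factorisation of a unitary matrix are unitary (adapted frame of `U(T ⊕ −T)`)

[cite: HarrisKudlaSweet1996, §1 (1.11); MoeglinVignerasWaldspurger1987, Chap. 2 II.8]

Over a commutative ring `L` with involution `σ`, in the adapted frame of `DoubledUnitaryAdaptedBlocks` (hermitian form
`antidiag(τ, τ)`, `τ = 2T`): if a product `p · u` of a block-upper-triangular `p = [[A, B], [0, D]]` and a
block-lower-unitriangular `u = [[1, 0], [X, 1]]` preserves `antidiag(τ, τ)`, then so do `p` AND `u` separately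
(`cstar_blockUpper_of_mul`, `cstar_lowerUnip_of_mul`; the latter says `Xᴴ τ + τ X = 0`). This is the algebraic
half of "the Iwahori factorisation `K = (P ∩ K)(N⁻ ∩ K)` of a congruence subgroup of `GL` restricts to the unitary
group": the `GL`-factors of a unitary element are automatically unitary. Also: the Weyl-type element
`s = [[0, 1], [1, 0]]` preserves the form and conjugates `[[1, 0], [X, 1]]` to `[[1, X], [0, 1]]`.
-/

set_option autoImplicit false

open scoped Matrix

namespace Literature.NumberTheory.GelbartRogawski1991.AdaptedBlocks

variable {L : Type*} [CommRing L] {ι : Type*} [Fintype ι] [DecidableEq ι] (σ : L →+* L) (τ : Matrix ι ι L)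

/-- the adapted hermitian product of `[[A,B],[0,D]] · [[1,0],[X,1]]` against `antidiag(τ, τ)`, block by block.
[cite: HarrisKudlaSweet1996, §1 (1.11)] -/
theorem cstar_blockUpper_mul_lowerUnip (A B D X : Matrix ι ι L) :
    (((Matrix.fromBlocks A B 0 D * Matrix.fromBlocks 1 0 X 1).map σ)ᵀ * Matrix.fromBlocks 0 τ τ 0 *
        (Matrix.fromBlocks A B 0 D * Matrix.fromBlocks 1 0 X 1)) =
      Matrix.fromBlocks
        ((X.map σ)ᵀ * (((D.map σ)ᵀ * τ * A)) + (((A.map σ)ᵀ * τ * D) + (X.map σ)ᵀ * ((D.map σ)ᵀ * τ * B + (B.map σ)ᵀ * τ * D)) * X)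
        (((A.map σ)ᵀ * τ * D) + (X.map σ)ᵀ * ((D.map σ)ᵀ * τ * B + (B.map σ)ᵀ * τ * D))
        ((D.map σ)ᵀ * τ * A + ((D.map σ)ᵀ * τ * B + (B.map σ)ᵀ * τ * D) * X)
        ((D.map σ)ᵀ * τ * B + (B.map σ)ᵀ * τ * D) := by
  simp only [Matrix.fromBlocks_multiply, Matrix.fromBlocks_map, Matrix.fromBlocks_transpose,
    Matrix.map_mul, Matrix.map_add _ (map_add σ), Matrix.transpose_mul,
    Matrix.transpose_add, Matrix.mul_zero, Matrix.mul_one, zero_add, add_zero, Matrix.mul_add, Matrix.add_mul,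
    Matrix.mul_assoc]
  congr 1 <;> abel

/-- the adapted hermitian product of a block-upper-triangular `[[A,B],[0,D]]` against `antidiag(τ, τ)`.
[cite: HarrisKudlaSweet1996, §1 (1.11)] -/
theorem cstar_blockUpper (A B D : Matrix ι ι L) :
    ((Matrix.fromBlocks A B 0 D).map σ)ᵀ * Matrix.fromBlocks 0 τ τ 0 * Matrix.fromBlocks A B 0 D =
      Matrix.fromBlocks 0 ((A.map σ)ᵀ * τ * D) ((D.map σ)ᵀ * τ * A) ((D.map σ)ᵀ * τ * B + (B.map σ)ᵀ * τ * D) := by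
  have h := cstar_blockUpper_mul_lowerUnip σ τ A B D 0
  simp only [Matrix.map_zero _ (map_zero σ), Matrix.transpose_zero, Matrix.zero_mul, Matrix.mul_zero,
    add_zero] at h
  have e : Matrix.fromBlocks A B 0 D * Matrix.fromBlocks (1 : Matrix ι ι L) 0 0 (1 : Matrix ι ι L) = Matrix.fromBlocks A B 0 D := by
    rw [Matrix.fromBlocks_multiply]; simp
  rw [e] at h
  exact h

/-- the adapted hermitian product of a block-lower-unitriangular `[[1,0],[X,1]]` against `antidiag(τ, τ)`.
[cite: HarrisKudlaSweet1996, §1 (1.11)] -/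
theorem cstar_lowerUnip (X : Matrix ι ι L) :
    ((Matrix.fromBlocks 1 0 X 1).map σ)ᵀ * Matrix.fromBlocks 0 τ τ 0 * Matrix.fromBlocks 1 0 X 1 =
      Matrix.fromBlocks ((X.map σ)ᵀ * τ + τ * X) τ τ 0 := by
  have h := cstar_blockUpper_mul_lowerUnip σ τ 1 0 1 X
  simp only [Matrix.map_zero _ (map_zero σ), Matrix.map_one σ (map_zero σ) (map_one σ), Matrix.transpose_zero,
    Matrix.transpose_one, Matrix.zero_mul, Matrix.mul_zero, Matrix.one_mul, Matrix.mul_one, add_zero] at h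
  have e : Matrix.fromBlocks (1 : Matrix ι ι L) 0 0 (1 : Matrix ι ι L) * Matrix.fromBlocks 1 0 X 1 = Matrix.fromBlocks 1 0 X 1 := by
    rw [Matrix.fromBlocks_multiply]; simp
  rw [e] at h
  exact h

/-- **the factors of an Iwahori factorisation of a unitary element are unitary**: if `[[A,B],[0,D]] · [[1,0],[X,1]]`
preserves `antidiag(τ, τ)` then so does `[[A,B],[0,D]]` … [cite: MoeglinVignerasWaldspurger1987, Chap. 2 II.8;
HarrisKudlaSweet1996, §1 (1.11)] -/
theorem cstar_blockUpper_of_mul {A B D X : Matrix ι ι L}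
    (h : (((Matrix.fromBlocks A B 0 D * Matrix.fromBlocks 1 0 X 1).map σ)ᵀ * Matrix.fromBlocks 0 τ τ 0 *
        (Matrix.fromBlocks A B 0 D * Matrix.fromBlocks 1 0 X 1)) = Matrix.fromBlocks 0 τ τ 0) :
    ((Matrix.fromBlocks A B 0 D).map σ)ᵀ * Matrix.fromBlocks 0 τ τ 0 * Matrix.fromBlocks A B 0 D = Matrix.fromBlocks 0 τ τ 0 := by
  rw [cstar_blockUpper_mul_lowerUnip] at h
  obtain ⟨-, h₁₂, h₂₁, h₂₂⟩ := Matrix.fromBlocks_inj.1 h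
  rw [h₂₂, Matrix.mul_zero, add_zero] at h₁₂
  rw [h₂₂, Matrix.zero_mul, add_zero] at h₂₁
  rw [cstar_blockUpper, h₁₂, h₂₁, h₂₂]

/-- … and so does `[[1,0],[X,1]]`, i.e. `Xᴴ τ + τ X = 0`. [cite: MoeglinVignerasWaldspurger1987, Chap. 2 II.8;
HarrisKudlaSweet1996, §1 (1.11)] -/
theorem cstar_lowerUnip_of_mul {A B D X : Matrix ι ι L}
    (h : (((Matrix.fromBlocks A B 0 D * Matrix.fromBlocks 1 0 X 1).map σ)ᵀ * Matrix.fromBlocks 0 τ τ 0 *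
        (Matrix.fromBlocks A B 0 D * Matrix.fromBlocks 1 0 X 1)) = Matrix.fromBlocks 0 τ τ 0) :
    (X.map σ)ᵀ * τ + τ * X = 0 := by
  rw [cstar_blockUpper_mul_lowerUnip] at h
  obtain ⟨h₁₁, h₁₂, h₂₁, h₂₂⟩ := Matrix.fromBlocks_inj.1 h
  rw [h₂₂, Matrix.mul_zero, add_zero] at h₁₂
  rw [h₂₂, Matrix.zero_mul, add_zero] at h₂₁
  rw [h₂₂, Matrix.mul_zero, add_zero, h₁₂, h₂₁] at h₁₁
  rw [← h₁₁, add_comm]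

/-- the unitarity of `[[1,0],[X,1]]` for `Xᴴ τ + τ X = 0`. [cite: HarrisKudlaSweet1996, §1 (1.11)] -/
theorem cstar_lowerUnip_of_skew {X : Matrix ι ι L} (hX : (X.map σ)ᵀ * τ + τ * X = 0) :
    ((Matrix.fromBlocks 1 0 X 1).map σ)ᵀ * Matrix.fromBlocks 0 τ τ 0 * Matrix.fromBlocks 1 0 X 1 = Matrix.fromBlocks 0 τ τ 0 := by
  rw [cstar_lowerUnip, hX]

/-- the unitarity of `[[1,X],[0,1]]` for `Xᴴ τ + τ X = 0`. [cite: HarrisKudlaSweet1996, §1 (1.11)] -/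
theorem cstar_upperUnip_of_skew {X : Matrix ι ι L} (hX : (X.map σ)ᵀ * τ + τ * X = 0) :
    ((Matrix.fromBlocks (1 : Matrix ι ι L) X 0 1).map σ)ᵀ * Matrix.fromBlocks 0 τ τ 0 * Matrix.fromBlocks (1 : Matrix ι ι L) X 0 1 =
      Matrix.fromBlocks 0 τ τ 0 := by
  rw [cstar_blockUpper]
  simp only [Matrix.map_one σ (map_zero σ) (map_one σ), Matrix.transpose_one, Matrix.one_mul, Matrix.mul_one]
  rw [add_comm, hX]

omit [Fintype ι] in
/-- the adapted Weyl element `s = [[0,1],[1,0]]` squares to `1`. [cite: Kudla1994, §3] -/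
theorem weylAd_mul_weylAd [Fintype ι] :
    Matrix.fromBlocks (0 : Matrix ι ι L) (1 : Matrix ι ι L) (1 : Matrix ι ι L) 0 * Matrix.fromBlocks (0 : Matrix ι ι L) (1 : Matrix ι ι L) (1 : Matrix ι ι L) 0 = 1 := by
  rw [Matrix.fromBlocks_multiply, ← Matrix.fromBlocks_one]; simp

/-- `s` preserves `antidiag(τ, τ)`. [cite: Kudla1994, §3] -/
theorem cstar_weylAd : ((Matrix.fromBlocks (0 : Matrix ι ι L) (1 : Matrix ι ι L) (1 : Matrix ι ι L) 0).map σ)ᵀ *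
    Matrix.fromBlocks 0 τ τ 0 * Matrix.fromBlocks (0 : Matrix ι ι L) (1 : Matrix ι ι L) (1 : Matrix ι ι L) 0 = Matrix.fromBlocks 0 τ τ 0 := by
  rw [Matrix.fromBlocks_map, Matrix.fromBlocks_transpose, Matrix.map_zero _ (map_zero σ), Matrix.map_one σ (map_zero σ) (map_one σ),
    Matrix.transpose_zero, Matrix.transpose_one, Matrix.fromBlocks_multiply, Matrix.fromBlocks_multiply]
  simp

/-- `s · [[1,0],[X,1]] · s = [[1,X],[0,1]]`: the lower unipotents are the `s`-conjugates of the upper ones.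
[cite: Kudla1994, §3] -/
theorem weylAd_mul_lowerUnip_mul_weylAd (X : Matrix ι ι L) :
    Matrix.fromBlocks (0 : Matrix ι ι L) (1 : Matrix ι ι L) (1 : Matrix ι ι L) 0 * Matrix.fromBlocks 1 0 X 1 *
      Matrix.fromBlocks (0 : Matrix ι ι L) (1 : Matrix ι ι L) (1 : Matrix ι ι L) 0 = Matrix.fromBlocks 1 X 0 1 := by
  rw [Matrix.fromBlocks_multiply, Matrix.fromBlocks_multiply]; simp

/-! ## `ν = −C⁻¹ D` is skew on the big cell (from the inverse relation) -/

section Skew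

/-- from the inverse relation `D T⁻¹ Cᴴ + C T⁻¹ Dᴴ = 0` with `C` invertible: `X = C⁻¹ D` satisfies `Xᴴ T + T X = 0`.
[cite: Kudla1994, §3; HarrisKudlaSweet1996, §1 (1.12)] -/
theorem cstar_invMul_skew {σ : L →+* L} {T C D : Matrix ι ι L} (hT : IsUnit T.det) (hC : IsUnit C.det)
    (h : D * T⁻¹ * (C.map σ)ᵀ + C * T⁻¹ * (D.map σ)ᵀ = 0) :
    ((C⁻¹ * D).map σ)ᵀ * T + T * (C⁻¹ * D) = 0 := by
  have hCs : IsUnit ((C.map σ)ᵀ).det := by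
    rw [Matrix.det_transpose, ← RingHom.mapMatrix_apply, ← RingHom.map_det]; exact hC.map _
  -- `(C⁻¹)ᴴ = (Cᴴ)⁻¹`
  have hinv : ((C⁻¹).map σ)ᵀ = ((C.map σ)ᵀ)⁻¹ := by
    refine (Matrix.inv_eq_right_inv ?_).symm
    rw [← Matrix.transpose_mul, ← Matrix.map_mul, Matrix.nonsing_inv_mul C hC, Matrix.map_one σ (map_zero σ) (map_one σ),
      Matrix.transpose_one]
  -- `C⁻¹ · h · (Cᴴ)⁻¹`: `C⁻¹ D T⁻¹ + T⁻¹ Dᴴ (Cᴴ)⁻¹ = 0`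
  have h1 : C⁻¹ * (D * T⁻¹) + T⁻¹ * ((D.map σ)ᵀ * ((C.map σ)ᵀ)⁻¹) = 0 := by
    have h' := congrArg (fun X => C⁻¹ * X * ((C.map σ)ᵀ)⁻¹) h
    simp only [Matrix.mul_add, Matrix.add_mul, Matrix.mul_zero, Matrix.zero_mul, Matrix.mul_assoc] at h'
    rwa [Matrix.mul_nonsing_inv _ hCs, Matrix.mul_one, Matrix.nonsing_inv_mul_cancel_left _ _ hC] at h'
  -- `T · h1 · T`
  have h2 := congrArg (fun X => T * X * T) h1
  simp only [Matrix.mul_add, Matrix.add_mul, Matrix.mul_zero, Matrix.zero_mul] at h2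
  rw [Matrix.mul_nonsing_inv_cancel_left _ _ hT, Matrix.mul_assoc T, Matrix.mul_assoc C⁻¹, Matrix.mul_assoc D,
    Matrix.nonsing_inv_mul T hT, Matrix.mul_one] at h2
  rw [Matrix.map_mul, Matrix.transpose_mul, hinv, add_comm]
  exact h2

/-- the same for `ν = −C⁻¹ D`: `νᴴ T + T ν = 0`. [cite: Kudla1994, §3; HarrisKudlaSweet1996, §1 (1.12)] -/
theorem cstar_neg_invMul_skew {σ : L →+* L} {T C D : Matrix ι ι L} (hT : IsUnit T.det) (hC : IsUnit C.det)
    (h : D * T⁻¹ * (C.map σ)ᵀ + C * T⁻¹ * (D.map σ)ᵀ = 0) :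
    ((-(C⁻¹ * D)).map σ)ᵀ * T + T * (-(C⁻¹ * D)) = 0 := by
  have e : (-(C⁻¹ * D)).map σ = -((C⁻¹ * D).map σ) := by
    ext i j; simp only [Matrix.map_apply, Matrix.neg_apply, map_neg]
  rw [e, Matrix.transpose_neg, Matrix.neg_mul, Matrix.mul_neg, ← neg_add, cstar_invMul_skew hT hC h, neg_zero]


omit [DecidableEq ι] in
/-- skewness for `T` and for `2 • T` are the same condition, up to the factor `2`. [cite: HarrisKudlaSweet1996, §1 (1.11)] -/
theorem cstar_skew_two_smul {σ : L →+* L} {T X : Matrix ι ι L} (h : (X.map σ)ᵀ * T + T * X = 0) :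
    (X.map σ)ᵀ * ((2 : L) • T) + ((2 : L) • T) * X = 0 := by
  rw [Matrix.mul_smul, Matrix.smul_mul, ← smul_add, h, smul_zero]

end Skew

end Literature.NumberTheory.GelbartRogawski1991.AdaptedBlocks
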